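import Summits.BirchSwinnertonDyer.BirchSwinnertonDyer.Theorems.ManinLocalTwoThreeCuspFunShiftOperators
import Summits.BirchSwinnertonDyer.BirchSwinnertonDyer.Theorems.ManinLocalTwoThreeBoundaryEisenstein
import HarnessLib

/-!
# The transposed cusp module is Eisenstein: `T♯_r = r ρ_r + ρ_r⁻¹` on invariant cusp functions

Summit `BirchSwinnertonDyer`, route `ManinLocalTwoThree` (cell bsd-f2-manin), cruxes C2 `ManinOddAtFour`
(stmt-BirchSwinnertonDyer-22967) / C3 `ManinPrimeToThreeAtNine` (stmt-BirchSwinnertonDyer-22968).  Second file of N4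
PARABOLICITY (MEMO-es §22.2 (0); REF1 §R43 N4): the Hecke operator of `Hom(Γ₀(L), K)` evaluated on the parabolic elements
`g_x T^w g_x⁻¹` acts on the cusp data `x ↦ u(g_x T^w g_x⁻¹)` as `T♯_r = r A_r + B_r`
(`A_r = LinearMap.funLeft K K (heckeNbrInfty hr)`, `B_r = LinearMap.funLeft K K (heckeNbrZero hr)`) — the TRANSPOSE of the
weights `A_r + r B_r` of E-es-30.  **`sharpEisenstein_cuspFun`**: over an algebraically closed field, a function
`a ∈ cuspInvariants M K` lying in the generalised `λ(r)`-eigenspace of `T♯_r` for every prime `r ∉ S` (`S ⊇` primes of `M`)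
vanishes unless `λ` is a weight-`2` Eisenstein system; indeed a common `A`-eigenvector `v` (`A_r v = χ_r v`) has
`T♯_r v = (r χ_r + χ_r⁻¹) v`, so `λ(r) = ψ⁻¹(r) + r ψ(r)` with `ψ` the Dirichlet character mod `M` through the `χ_r`
(Dirichlet's theorem names each unit class by a prime).  Same proof as `boundaryEisenstein`
(`Theorems/ManinLocalTwoThreeBoundaryEisenstein.lean`, whose `exists_common_eigenvector` is reused), on functions instead of
boundary symbols (no constants to quotient by).  No new definitions; nothing about BSD or Manin's conjecture is proved here.

References: G. Stevens, *Arithmetic on modular curves* (1982) Ch. 1–2; F. Diamond, J. Shurman, GTM 228, Prop. 5.2.3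
[cite: DiamondShurman2005, Prop. 5.2.3 (p. 173)]; cell memo HOME/MEMO-es.md §22.2–22.3.
-/

set_option autoImplicit false
set_option linter.dupNamespace false

open scoped MatrixGroups

open CongruenceSubgroup Matrix.SpecialLinearGroup Literature.NumberTheory.EllipticCurves.ModularForms

namespace Summit.BirchSwinnertonDyer.BirchSwinnertonDyer.Theorems.ManinLocalTwoThree

section Sharp

variable (M : ℕ) [NeZero M] {K : Type*} [Field K] [IsAlgClosed K]

/-- **Transposed E-es-30 (function form).**  `S ⊇` primes of `M`, `λ : ℕ → K`, `K` algebraically closed.  If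
`a ∈ cuspInvariants M K` lies in the generalised `λ(r)`-eigenspace of `T♯_r = r • A_r + B_r` for every prime `r ∉ S`, and
`λ` is not a weight-`2` Eisenstein system, then `a = 0`. [cite: DiamondShurman2005, Prop. 5.2.3 (p. 173)] -/
theorem sharpEisenstein_cuspFun (S : Finset ℕ) (hS : ∀ q : ℕ, q.Prime → q ∣ M → q ∈ S) (lam : ℕ → K)
    (a : OnePoint ℚ → K) (ha : a ∈ cuspInvariants M K)
    (heig : ∀ (r : ℕ) [NeZero r] (hr : r.Prime), r ∉ S → a ∈ Module.End.maxGenEigenspace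
      ((r : K) • LinearMap.funLeft K K (heckeNbrInfty hr) + LinearMap.funLeft K K (heckeNbrZero hr)) (lam r))
    (hne : ¬ IsEisensteinEigensystem 2 lam) : a = 0 := by
  classical
  by_contra ha0
  apply hne
  let ι := {q : ℕ // q.Prime ∧ ¬ q ∣ M}
  haveI hnz : ∀ i : ι, NeZero i.1 := fun i ↦ ⟨i.2.1.ne_zero⟩
  let A : ι → Module.End K (OnePoint ℚ → K) := fun i ↦ LinearMap.funLeft K K (heckeNbrInfty i.2.1)
  let ιS := {r : ℕ // r.Prime ∧ r ∉ S}
  have hιS : ∀ r : ιS, ¬ r.1 ∣ M := fun r h ↦ r.2.2 (hS r.1 r.2.1 h)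
  haveI hnzS : ∀ r : ιS, NeZero r.1 := fun r ↦ ⟨r.2.1.ne_zero⟩
  let Tsh : ιS → Module.End K (OnePoint ℚ → K) := fun r ↦
    (r.1 : K) • LinearMap.funLeft K K (heckeNbrInfty r.2.1) + LinearMap.funLeft K K (heckeNbrZero r.2.1)
  let V : Submodule K (OnePoint ℚ → K) := cuspInvariants M K
  let E : Submodule K (OnePoint ℚ → K) := V ⊓ ⨅ r : ιS, Module.End.maxGenEigenspace (Tsh r) (lam r.1)
  have haE : a ∈ E := by
    refine Submodule.mem_inf.mpr ⟨ha, ?_⟩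
    rw [Submodule.mem_iInf]
    intro r
    exact heig r.1 r.2.1 r.2.2
  have hE0 : E ≠ ⊥ := fun h ↦ ha0 ((Submodule.eq_bot_iff _).mp h a haE)
  haveI : FiniteDimensional K V := finiteDimensional_cuspInvariants M K
  haveI : FiniteDimensional K E := Submodule.finiteDimensional_of_le (inf_le_left : E ≤ V)
  have hEV : ∀ w ∈ E, w ∈ V := fun w hw ↦ (Submodule.mem_inf.mp hw).1
  have hEst : ∀ i : ι, ∀ w ∈ E, A i w ∈ E := by
    intro i w hw
    obtain ⟨hwV, hwg⟩ := Submodule.mem_inf.mp hw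
    rw [Submodule.mem_iInf] at hwg
    refine Submodule.mem_inf.mpr ⟨funLeft_heckeNbrInfty_mem M i.2.1 i.2.2 hwV, ?_⟩
    rw [Submodule.mem_iInf]
    intro r
    exact funLeft_mem_maxGenEigenspace_sharp M r.2.1 i.2.1 (hιS r) i.2.2 hwV (hwg r)
  have hEcomm : ∀ i j : ι, ∀ w ∈ E, A i (A j w) = A j (A i w) := by
    intro i j w hw
    exact funLeft_infty_comm M j.2.1 i.2.1 j.2.2 i.2.2 (hEV w hw)
  obtain ⟨v, hvE, hv0, hev⟩ := exists_common_eigenvector A E hE0 hEst hEcomm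
  choose χ hχ using hev
  have hvV : v ∈ V := hEV v hvE
  have hAv : ∀ i : ι, LinearMap.funLeft K K (heckeNbrInfty i.2.1) v = χ i • v := fun i ↦ hχ i
  have hχne : ∀ i : ι, χ i ≠ 0 := by
    intro i hzero
    have h1 := funLeft_zero_infty M i.2.1 i.2.2 hvV
    rw [hAv i, hzero, zero_smul, map_zero] at h1
    exact hv0 h1.symm
  have hBv : ∀ i : ι, LinearMap.funLeft K K (heckeNbrZero i.2.1) v = (χ i)⁻¹ • v := by
    intro i
    have h1 := funLeft_zero_infty M i.2.1 i.2.2 hvV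
    rw [hAv i, map_smul] at h1
    calc LinearMap.funLeft K K (heckeNbrZero i.2.1) v
        = (χ i)⁻¹ • (χ i • LinearMap.funLeft K K (heckeNbrZero i.2.1) v) := by
          rw [smul_smul, inv_mul_cancel₀ (hχne i), one_smul]
      _ = (χ i)⁻¹ • v := by rw [h1]
  have hinj : ∀ {c c' : K}, c • v = c' • v → c = c' := fun h ↦ smul_left_injective K hv0 h
  -- `λ(r) = r χ_r + χ_r⁻¹`
  have hlam : ∀ (r : ℕ) (hr : r.Prime) (hrS : r ∉ S),
      lam r = (r : K) * χ ⟨r, hr, fun h ↦ hrS (hS r hr h)⟩ + (χ ⟨r, hr, fun h ↦ hrS (hS r hr h)⟩)⁻¹ := by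
    intro r hr hrS
    have hrM : ¬ r ∣ M := fun h ↦ hrS (hS r hr h)
    haveI : NeZero r := ⟨hr.ne_zero⟩
    set i : ι := ⟨r, hr, hrM⟩ with hi
    set μ : K := (r : K) * χ i + (χ i)⁻¹ with hμ
    set T : Module.End K (OnePoint ℚ → K) :=
      (r : K) • LinearMap.funLeft K K (heckeNbrInfty hr) + LinearMap.funLeft K K (heckeNbrZero hr) with hT
    have hTv : T v = μ • v := by
      rw [hT, LinearMap.add_apply, LinearMap.smul_apply, hAv i, hBv i, smul_smul, ← add_smul]
    have hgen : v ∈ Module.End.maxGenEigenspace T (lam r) := by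
      have h := (Submodule.mem_inf.mp hvE).2
      rw [Submodule.mem_iInf] at h
      exact h ⟨r, hr, hrS⟩
    rw [Module.End.mem_maxGenEigenspace] at hgen
    obtain ⟨k, hk⟩ := hgen
    have hpow : ∀ n : ℕ, ((T - lam r • 1) ^ n) v = ((μ - lam r) ^ n) • v := by
      intro n
      induction n with
      | zero => simp
      | succ n ih =>
        rw [pow_succ, Module.End.mul_apply, LinearMap.sub_apply, LinearMap.smul_apply, Module.End.one_apply, hTv,
          ← sub_smul, map_smul, ih, smul_smul, ← pow_succ']
    rw [hpow k] at hk
    have hzero : (μ - lam r) ^ k = 0 := by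
      rcases smul_eq_zero.mp hk with h | h
      · exact h
      · exact absurd h hv0
    have hml : μ - lam r = 0 := (pow_eq_zero_iff'.mp hzero).1
    rw [sub_eq_zero] at hml
    rw [← hml]
  -- Dirichlet character through the `χ_q`
  have hq : ∀ u : (ZMod M)ˣ, ∃ p : ℕ, p.Prime ∧ (p : ZMod M) = u := fun u ↦ by
    obtain ⟨p, -, hp, hpu⟩ := Nat.forall_exists_prime_gt_and_eq_mod u.isUnit 0
    exact ⟨p, hp, hpu⟩
  choose qf hqf_prime hqf_eq using hq
  have hqf_not_dvd : ∀ u : (ZMod M)ˣ, ¬ qf u ∣ M := by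
    intro u hdvd
    have hu : IsUnit ((qf u : ℕ) : ZMod M) := by rw [hqf_eq u]; exact u.isUnit
    exact ((ZMod.isUnit_prime_iff_not_dvd (hqf_prime u)).mp hu) hdvd
  haveI hqnz : ∀ u : (ZMod M)ˣ, NeZero (qf u) := fun u ↦ ⟨(hqf_prime u).ne_zero⟩
  let ιOf : (ZMod M)ˣ → ι := fun u ↦ ⟨qf u, hqf_prime u, hqf_not_dvd u⟩
  have hone : χ (ιOf 1) = 1 := by
    have hcong : (M : ℤ) ∣ (qf 1 : ℤ) - 1 := by
      have h := hqf_eq 1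
      rw [Units.val_one, ← Nat.cast_one] at h
      exact int_dvd_sub_of_natCast_eq h
    have h1 := funLeft_infty_of_dvd_sub_one M (hqf_prime 1) (hqf_not_dvd 1) hcong hvV
    rw [hAv (ιOf 1)] at h1
    exact hinj (by rw [h1, one_smul])
  have hmul : ∀ u u' : (ZMod M)ˣ, χ (ιOf (u * u')) = χ (ιOf u) * χ (ιOf u') := by
    intro u u'
    have hcong : (M : ℤ) ∣ (qf u : ℤ) * (qf u') - qf (u * u') := by
      have h : ((qf u * qf u' : ℕ) : ZMod M) = (qf (u * u') : ZMod M) := by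
        rw [Nat.cast_mul, hqf_eq u, hqf_eq u', hqf_eq (u * u'), Units.val_mul]
      have h' := int_dvd_sub_of_natCast_eq h
      push_cast at h'
      exact h'
    have h1 := funLeft_infty_mul_of_dvd M (hqf_prime u) (hqf_prime u') (hqf_prime (u * u')) (hqf_not_dvd u)
      (hqf_not_dvd u') (hqf_not_dvd (u * u')) hcong hvV
    rw [hAv (ιOf u), map_smul, hAv (ιOf u'), hAv (ιOf (u * u')), smul_smul] at h1
    exact (hinj h1).symm
  let ψu : (ZMod M)ˣ →* Kˣ :=
    { toFun := fun u ↦ Units.mk0 (χ (ιOf u)) (hχne _)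
      map_one' := Units.ext (by simp only [Units.val_mk0, Units.val_one, hone])
      map_mul' := fun u u' ↦ Units.ext (by simp only [Units.val_mk0, Units.val_mul, hmul]) }
  let ψ : DirichletCharacter K M := MulChar.ofUnitHom ψu
  have hψ : ∀ (ℓ : ℕ) (hℓ : ℓ.Prime) (hℓM : ¬ ℓ ∣ M), ψ (ℓ : ZMod M) = χ ⟨ℓ, hℓ, hℓM⟩ := by
    intro ℓ hℓ hℓM
    let u : (ZMod M)ˣ := ZMod.unitOfCoprime ℓ ((Nat.Prime.coprime_iff_not_dvd hℓ).mpr hℓM)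
    have hu : (u : ZMod M) = (ℓ : ZMod M) := ZMod.coe_unitOfCoprime ℓ _
    rw [← hu, show ψ (u : ZMod M) = (ψu u : K) from MulChar.ofUnitHom_coe ψu u]
    show χ (ιOf u) = χ ⟨ℓ, hℓ, hℓM⟩
    have hcong : (M : ℤ) ∣ (qf u : ℤ) - ℓ := int_dvd_sub_of_natCast_eq (by rw [hqf_eq u, hu])
    haveI : NeZero ℓ := ⟨hℓ.ne_zero⟩
    have h1 := funLeft_infty_congr M (hqf_prime u) hℓ (hqf_not_dvd u) hℓM hcong hvV
    rw [hAv (ιOf u), hAv ⟨ℓ, hℓ, hℓM⟩] at h1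
    exact hinj h1
  refine ⟨S, M, ψ⁻¹, ψ, Nat.pos_of_ne_zero (NeZero.ne M), fun ℓ hℓ hℓS ↦ ?_⟩
  have hℓM : ¬ ℓ ∣ M := fun h ↦ hℓS (hS ℓ hℓ h)
  rw [MulChar.inv_apply_eq_inv', hψ ℓ hℓ hℓM, hlam ℓ hℓ hℓS]
  norm_num
  ring

end Sharp

end Summit.BirchSwinnertonDyer.BirchSwinnertonDyer.Theorems.ManinLocalTwoThree
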